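import Summits.QuantumFields.YangMills.Theorems.SwapVirialDeficitBlowUpGnomonicFibreHessianPackage
import Summits.QuantumFields.YangMills.Theorems.SwapVirialDeficitBlowUpGnomonicFollowerCoercivityJets
import HarnessLib

/-!
# Route `SwapVirialDeficit` (YangMills): THE EUCLIDEAN FOLLOWER FIBRE at fixed leaders — `V_F = ℝ^{Fol L × Fin 3}` ⊂ `V_L`, its embedding, gauge, jets
# (definitions + API; cell ym-idea-1, LEAD g98 memo6∕7 (S-core)(b): the follower Gaussian CEILING `J(C) ≤ e^{−b m(C)}·e·(2π∕b)^{3|Fol|∕2}∕√det A_F + far` at fixed leaders)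

The core bound of skeleton ➎ integrates `e^{−bF̂}` over the FOLLOWERS at fixed (near-flat) leaders.  In the gnomonic chart with follower signs `+` the follower
letters of a point `η₀` with `η₀.2.2 = 0` move along `η₀ + ((0,0),(0,y))` (✓`gnoDeficit_followerLine_eq`: this IS the ring-side follower chart `U_f = gno⁺(y_f)` at the
leaders `C = (blowUpPoint 1 (gnomonicPoint a ε η₀)).1`).  This file gives that fibre its Euclidean dress, as a SUB-FIBRE of w2 g59's ✓`GnoFibre L`:
* §1 `GnoFol L := EuclideanSpace ℝ (Fol L × Fin 3)`; `gnoFolBlocks y : Fol L → Fin 3 → ℝ`; the isometric inclusion `gnoFolToFibre : GnoFol L →ₗᵢ[ℝ] GnoFibre L`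
  (zero `u, v, z` blocks); `gnoFolEmb := gnoFibreEmb ∘ gnoFolToFibre : GnoFol L →L[ℝ] GnoCoord L`; `gnoFolBlocksEquiv : GnoFol L ≃ᵐ (Fol L → Fin 3 → ℝ)` (volume-preserving);
* §2 API: `gnoFolEmb_apply` (`= ((0,0),(0, gnoFolBlocks y))`), `norm_gnoFolToFibre`, `norm_sq_gnoFol` (`‖y‖² = Σ_f |y_f|²`), `finrank_gnoFol_real` (`= 3|Fol L|`),
  `gnoDeficit_gnoFolEmb_eq_chart` (the ring-side follower chart, from ✓`gnoDeficit_followerLine_eq`);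
* §3 smoothness and jets of the follower restriction `y ↦ F̂(η + gnoFolEmb y)` at ANY `η`: `contDiff_gnoDeficit_fol`, ★ `fol_third_bound` (`|D³[u,u,u]| ≤ 2484000L⁴‖u‖³`,
  from ✓`fibre_third_bound` through the isometric inclusion and `ContinuousLinearMap.iteratedFDeriv_comp_right`), `fol_second_bound` (`≤ 20400L⁴‖u‖²`).
With §3, ✓`hessian_lower_on_closedBall_of_cubes` (file ✓`…QuantitativeLaplaceThirdSymm`) transfers the follower coercivity at `y = 0` (✓`gnoFollower_raySecond_coercive_gnomonic`)
to the gnomonic follower minimiser (✓`exists_gnoMinimiser_in_box_twisted`), and ✓`form_floor_of_third_directional` + ✓`setIntegral_exp_neg_mul_le_gaussian_add_tail` give the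
ceiling — next files.

HONEST LABEL: definitions and calculus API only; the follower ceiling, the core bound, all region stubs, ⟨24197⟩ ∕ ⟨24194⟩ OPEN; own crux ⟨22884⟩ OPEN (blocked-on ⟨19935⟩);
the Yang–Mills mass gap is NOT proved; no summit is proved by a line.  No instance, no notation, 0 `sorry`, standard axioms.  Width seat ym-line-sfw-p2-w2 g59 (cell ym-idea-1,
free hands), `--supports stmt-QuantumFields-24197`.  References: [cite: Luscher1983, §2]; [folklore].
-/

set_option autoImplicit false
set_option synthInstance.maxSize 1024

noncomputable section

open MeasureTheory Quaternion Set Metric Module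
open scoped Quaternion BigOperators ENNReal InnerProductSpace
open Literature.MathematicalPhysics.QuantumLattice
open Literature.MathematicalPhysics.QuantumFieldTheory hiding SU2

namespace Summit.QuantumFields.YangMills.Theorems.SwapVirialDeficit.BlowUpRing

open Summit.QuantumFields.YangMills.Theorems.FemtoTransferGap
open Summit.QuantumFields.YangMills.Theorems.FemtoTransferGap.TT
open Summit.QuantumFields.YangMills.Theorems.VirialFluxGap.RingDeficit
open Summit.QuantumFields.YangMills.Theorems.SwapVirialDeficit.SwapRing
open Summit.QuantumFields.YangMills.Theorems.SwapVirialDeficit.Gnomonic (normSq3 normSq3_nonneg contDiff_gnoDeficit)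

variable {L : ℕ} [NeZero L]

/-! ## §1 The follower fibre and its inclusion into `V_L` -/

variable (L) in
/-- THE EUCLIDEAN FOLLOWER FIBRE `V_F = ℝ^{Fol L × Fin 3}` (`3|Fol L|` dimensions). [folklore] -/
abbrev GnoFol : Type := EuclideanSpace ℝ (Fol L × Fin 3)

/-- The follower letters `y_f ∈ ℝ³` of a follower fibre vector. [folklore] -/
def gnoFolBlocks (y : GnoFol L) : Fol L → Fin 3 → ℝ := fun f k => y (f, k)

/-- THE ISOMETRIC INCLUSION `V_F ↪ V_L` (zero `u`, `v`, `z` blocks). [folklore] -/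
def gnoFolToFibre : GnoFol L →ₗᵢ[ℝ] GnoFibre L where
  toFun y := WithLp.toLp 2 (Sum.elim (Sum.elim (fun _ : Fin 2 => (0 : ℝ)) (fun _ : Fin 2 => (0 : ℝ))) (Sum.elim (fun _ : Fin 3 => (0 : ℝ)) (fun fk : Fol L × Fin 3 => y fk)))
  map_add' y y' := PiLp.ext fun i => by rcases i with ((j | j) | (k | fk)) <;> simp
  map_smul' c y := PiLp.ext fun i => by rcases i with ((j | j) | (k | fk)) <;> simp
  norm_map' y := by
    show ‖(WithLp.toLp 2 (Sum.elim (Sum.elim (fun _ : Fin 2 => (0 : ℝ)) (fun _ : Fin 2 => (0 : ℝ))) (Sum.elim (fun _ : Fin 3 => (0 : ℝ)) (fun fk : Fol L × Fin 3 => y fk))) :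
        GnoFibre L)‖ = ‖y‖
    have h : ‖(WithLp.toLp 2 (Sum.elim (Sum.elim (fun _ : Fin 2 => (0 : ℝ)) (fun _ : Fin 2 => (0 : ℝ))) (Sum.elim (fun _ : Fin 3 => (0 : ℝ)) (fun fk : Fol L × Fin 3 => y fk))) :
        GnoFibre L)‖ ^ 2 = ‖y‖ ^ 2 := by
      rw [EuclideanSpace.real_norm_sq_eq, EuclideanSpace.real_norm_sq_eq, Fintype.sum_sum_type, Fintype.sum_sum_type, Fintype.sum_sum_type]
      simp
    exact (sq_eq_sq₀ (norm_nonneg _) (norm_nonneg _)).1 h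

/-- THE FOLLOWER EMBEDDING `y ↦ ((0,0),(0, y))` into the gnomonic coordinates, a continuous linear map `V_F →L GnoCoord L`. [folklore] -/
def gnoFolEmb : GnoFol L →L[ℝ] GnoCoord L :=
  (gnoFibreEmb (L := L)).comp (gnoFolToFibre (L := L)).toContinuousLinearMap

/-- The follower fibre read as the letter family, a measurable equivalence (`ofLp`, then currying). [folklore] -/
def gnoFolBlocksEquiv : GnoFol L ≃ᵐ (Fol L → Fin 3 → ℝ) :=
  (MeasurableEquiv.toLp 2 (Fol L × Fin 3 → ℝ)).symm.trans (MeasurableEquiv.curry (Fol L) (Fin 3) ℝ)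

/-! ## §2 API -/

omit [NeZero L] in
/-- The block reading IS `gnoFolBlocks` (by `rfl`). [folklore] -/
theorem gnoFolBlocksEquiv_apply (y : GnoFol L) : gnoFolBlocksEquiv y = gnoFolBlocks y := rfl

/-- The block reading preserves volume. [folklore] -/
theorem volume_preserving_gnoFolBlocksEquiv : MeasurePreserving (gnoFolBlocksEquiv (L := L)) volume volume :=
  (PiLp.volume_preserving_ofLp (Fol L × Fin 3)).trans (QuantitativeLaplace.volume_preserving_curry (ι := Fol L) (κ := Fin 3) (X := ℝ))

/-- The inclusion, coordinatewise. [folklore] -/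
theorem gnoFolToFibre_apply (y : GnoFol L) :
    gnoFolToFibre y = WithLp.toLp 2 (Sum.elim (Sum.elim (fun _ : Fin 2 => (0 : ℝ)) (fun _ : Fin 2 => (0 : ℝ))) (Sum.elim (fun _ : Fin 3 => (0 : ℝ)) (fun fk : Fol L × Fin 3 => y fk))) :=
  rfl

/-- The inclusion is an isometry: `‖gnoFolToFibre y‖ = ‖y‖`. [folklore] -/
theorem norm_gnoFolToFibre (y : GnoFol L) : ‖gnoFolToFibre y‖ = ‖y‖ := (gnoFolToFibre (L := L)).norm_map y

/-- The blocks of the included vector: `u = v = 0`, `z = 0`, `η_F = gnoFolBlocks y`. [folklore] -/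
theorem gnoFibreBlocks_gnoFolToFibre (y : GnoFol L) :
    gnoFibreBlocks (gnoFolToFibre y) = (((0 : Fin 2 → ℝ), (0 : Fin 2 → ℝ)), ((0 : Fin 3 → ℝ), gnoFolBlocks y)) := by
  simp only [gnoFibreBlocks, gnoFolToFibre_apply]
  rfl

/-- ★ The follower embedding, pointwise: `gnoFolEmb y = ((0, 0), (0, gnoFolBlocks y))`. [folklore] -/
theorem gnoFolEmb_apply (y : GnoFol L) :
    gnoFolEmb y = ((((0 : Fin 3 → ℝ), (0 : Fin 3 → ℝ)), ((0 : Fin 3 → ℝ), gnoFolBlocks y)) : GnoCoord L) := by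
  show gnoFibreEmb (gnoFolToFibre y) = _
  rw [gnoFibreEmb_eq_fibreDir, gnoFibreBlocks_gnoFolToFibre]
  refine Prod.ext (Prod.ext ?_ ?_) rfl
  · funext k; fin_cases k <;> rfl
  · funext k; fin_cases k <;> rfl

/-- `gnoFolEmb = gnoFibreEmb ∘ gnoFolToFibre`. [folklore] -/
theorem gnoFolEmb_eq_comp (y : GnoFol L) : gnoFolEmb y = gnoFibreEmb (gnoFolToFibre y) := rfl

/-- ★ **THE GAUGE IDENTITY**: `‖y‖² = Σ_f |y_f|²`. [folklore] -/
theorem norm_sq_gnoFol (y : GnoFol L) : ‖y‖ ^ 2 = ∑ f, normSq3 (gnoFolBlocks y f) := by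
  rw [EuclideanSpace.real_norm_sq_eq, Fintype.sum_prod_type]
  simp only [gnoFolBlocks, normSq3]

/-- Each follower letter is bounded by the norm: `|y_f|² ≤ ‖y‖²`. [folklore] -/
theorem normSq3_gnoFolBlocks_le (y : GnoFol L) (f : Fol L) : normSq3 (gnoFolBlocks y f) ≤ ‖y‖ ^ 2 := by
  rw [norm_sq_gnoFol]
  exact Finset.single_le_sum (f := fun f => normSq3 (gnoFolBlocks y f)) (fun f _ => normSq3_nonneg _) (Finset.mem_univ f)

/-- The follower fibre has dimension `3|Fol L|`. [folklore] -/
theorem finrank_gnoFol_real : (Module.finrank ℝ (GnoFol L) : ℝ) = 3 * (Fintype.card (Fol L) : ℝ) := by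
  rw [finrank_euclideanSpace, Fintype.card_prod, Fintype.card_fin]; push_cast; ring

/-- ★ **THE RING-SIDE FOLLOWER CHART**: for follower signs `+` and a point `η₀` with trivial followers,
`F̂_z(a,ε)(η₀ + gnoFolEmb y) = F̂_z(C, gno⁺(y))` with `C = (blowUpPoint 1 (gnomonicPoint a ε η₀)).1` (✓`gnoDeficit_followerLine_eq` at `s = 1`). [folklore] -/
theorem gnoDeficit_gnoFolEmb_eq_chart (z : Fin 3 → Bool) (χ : Site 3 L → SU2) (a : ℍ) (ε : GnoSign L) (η₀ : GnoCoord L)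
    (hε : ε.2.2 = fun _ => true) (hη : η₀.2.2 = 0) (y : GnoFol L) :
    gnoDeficit z χ a ε (η₀ + gnoFolEmb y) =
      chartDeficit L z χ ((blowUpPoint 1 (gnomonicPoint a ε η₀)).1, fun f => quatToSU2 (gnoLetter true (gnoFolBlocks y f))) := by
  have h := gnoDeficit_followerLine_eq z χ a ε η₀ hε hη (gnoFolBlocks y) 1
  rw [one_smul, one_smul] at h
  rw [gnoFolEmb_apply]
  exact h

/-! ## §3 Smoothness and jets of the follower restriction -/

/-- `y ↦ F̂(η + gnoFolEmb y)` is `C^n` (hub `a ≠ 0`). [cite: Luscher1983, §2] -/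
theorem contDiff_gnoDeficit_fol (z : Fin 3 → Bool) (χ : Site 3 L → SU2) {a : ℍ} (ha : a ≠ 0) (ε : GnoSign L) (η : GnoCoord L) {n : ℕ∞} :
    ContDiff ℝ n fun y : GnoFol L => gnoDeficit z χ a ε (η + gnoFolEmb y) :=
  (contDiff_gnoDeficit (n := n) z χ ha ε).comp (contDiff_const.add (gnoFolEmb (L := L)).contDiff)

/-- The follower restriction is the fibre restriction composed with the inclusion. [folklore] -/
theorem gnoDeficit_fol_eq_comp (z : Fin 3 → Bool) (χ : Site 3 L → SU2) (a : ℍ) (ε : GnoSign L) (η : GnoCoord L) :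
    (fun y : GnoFol L => gnoDeficit z χ a ε (η + gnoFolEmb y)) = (fun w : GnoFibre L => gnoDeficit z χ a ε (η + gnoFibreEmb w)) ∘ (gnoFolToFibre (L := L)).toContinuousLinearMap :=
  rfl

/-- ★ **THE DIRECTIONAL THIRD DERIVATIVE ON THE FOLLOWER FIBRE**: `|D³_y (F̂(η + gnoFolEmb ·))(y₀)[u,u,u]| ≤ 2484000L⁴‖u‖³` at EVERY `η`, `y₀`
(✓`fibre_third_bound` through the isometric inclusion). [cite: Luscher1983, §2] -/
theorem fol_third_bound (z : Fin 3 → Bool) (χ : Site 3 L → SU2) {a : ℍ} (ha : a ≠ 0) (ε : GnoSign L) (η : GnoCoord L) (y₀ u : GnoFol L) :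
    |iteratedFDeriv ℝ 3 (fun y : GnoFol L => gnoDeficit z χ a ε (η + gnoFolEmb y)) y₀ (fun _ => u)| ≤ 2484000 * (L : ℝ) ^ 4 * ‖u‖ ^ 3 := by
  rw [gnoDeficit_fol_eq_comp, ContinuousLinearMap.iteratedFDeriv_comp_right _ (contDiff_gnoDeficit_fibre z χ ha ε η) _ (by norm_cast)]
  have h := fibre_third_bound z χ ha ε η (gnoFolToFibre y₀) (gnoFolToFibre u)
  rw [norm_gnoFolToFibre] at h
  exact h

/-- ★ **THE DIRECTIONAL SECOND DERIVATIVE ON THE FOLLOWER FIBRE**: `|D²_y (F̂(η + gnoFolEmb ·))(y₀)[u,u]| ≤ 20400L⁴‖u‖²`. [cite: Luscher1983, §2] -/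
theorem fol_second_bound (z : Fin 3 → Bool) (χ : Site 3 L → SU2) {a : ℍ} (ha : a ≠ 0) (ε : GnoSign L) (η : GnoCoord L) (y₀ u : GnoFol L) :
    |iteratedFDeriv ℝ 2 (fun y : GnoFol L => gnoDeficit z χ a ε (η + gnoFolEmb y)) y₀ (fun _ => u)| ≤ 20400 * (L : ℝ) ^ 4 * ‖u‖ ^ 2 := by
  rw [gnoDeficit_fol_eq_comp, ContinuousLinearMap.iteratedFDeriv_comp_right _ (contDiff_gnoDeficit_fibre z χ ha ε η) _ (by norm_cast)]
  have h := fibre_second_bound z χ ha ε η (gnoFolToFibre y₀) (gnoFolToFibre u)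
  rw [norm_gnoFolToFibre] at h
  exact h

end Summit.QuantumFields.YangMills.Theorems.SwapVirialDeficit.BlowUpRing

end
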